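import Literature.NumberTheory.ModularForms.BinaryQuadGaussSumAllModuli
import Literature.NumberTheory.ModularForms.BinaryQuadGaussSumCoprime
import Literature.NumberTheory.Automorphic.BinaryThetaCuspTransform
import Literature.NumberTheory.LFunctions.ConreyIwaniec2002GaussSumGenus
import Literature.NumberTheory.LFunctions.PrimitiveQuadraticCharacterModulus
import HarnessLib

/-!
# Gauss sums of binary quadratic forms: the GENUS PHASE at every modulus — for `f` primitive of
# discriminant `−q` (`q` odd squarefree) with leading coefficient a unit mod `c`,
# `G(a,c;f,0) = (f.a/s)·E₀(a,c,q)` with `E₀` independent of `f` (`s = (c,q)`)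

Topic `NumberTheory/ModularForms`-adjacent, filed next to the Conrey–Iwaniec material it serves
(namespace `Literature.NumberTheory.LFunctions.ConreyIwaniec2002`); theorem-only (no definition,
no named fact). It is the ARITHMETIC half of stub Ω1 `stub_gauss_sum_genus` of the cell
`landau-siegel/ls-inputs` sub-sub-skeleton `theta-omega` (the hypothesis `hGP` of
`gauss_sum_genus_of_phase`, `ConreyIwaniec2002GaussSumGenus.lean`): print's statement that the
pseudo-eigenvalue of `θ(·;ψ)|_ω` "does not depend on the character `ψ`" (Propositions 3.2/3.3,
(3.15)/(3.17)), class by class.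

For `q` odd squarefree, `c = 2^k c'` (`c'` odd), `s = (c,q)` (odd, `s ∣ c'`, `c' = s·c₁`),
`r = q/s` (prime to `c`), a numerator `a` with `aā ≡ 1 (c)`, and `f = (A,B,C)` primitive with
`B² − 4AC = −q` (so `B` odd) and `A` a unit mod `c`:
`G(a,c;f,0) = G(c'a, 2^k; f,0)·G(2^k a, c'; f,0)` (CRT, `binQuadGaussSum_mul_of_coprime`),
`G(c'a,2^k;f,0) = χ₈(−q)^k 2^k` (`binQuadGaussSum_two_pow_eq`, `k ≥ 1`; `= 1` for `k = 0`), and by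
`binQuadGaussSum_zero_zero_eq_of_factorisation` (completing the square, odd modulus `c' = s·c₁`,
`−q = s·(−r)`, `(−r, c₁) = 1`):
`G(2^k a,c';f,0) = (2^ka/c')(2^ka/c₁)·(A/c')G(1;c')·s·(Ar/c₁)G(1;c₁)`, where
`(A/c')(Ar/c₁) = (A/s)(A/c₁)²(r/c₁) = (A/s)(r/c₁)` as `(A, c₁) = 1`. Hence

* `gauss_sum_phase` — `∃ E₀, ∀ f` (primitive, `disc f = −q`, `0 < f.a`, `f.a` a unit mod `c`):
  `binQuadGaussSum c f a 0 0 = (f.a/s)·E₀` — EXACTLY the hypothesis `hGP` of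
  `gauss_sum_genus_of_phase`;
* `gauss_sum_genus` — **stub Ω1 `stub_gauss_sum_genus` of the sub-sub-skeleton `theta-omega`
  (v1 bdf2bb0b06d7a5d7 :125), VERBATIM**: for every reduced form `Q` of discriminant `d_K = −q`,
  `G(a,c;Q,0) = E·ψ_s([𝔞_Q])` with one `E`, `‖E‖ = c√s` (`gauss_sum_genus_of_phase ∘ gauss_sum_phase`).

Numerics: HOME `S3/numerics/check_Omega1.py` (7337 Gauss sums: the class enters only through
`(n_f/s)`, 0 failures). «The programme SEARCHES and TYPES; no claim about Landau–Siegel zeros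
until a kernel theorem says so.»

## References

* [AndrianovZhuravlev2015] A. N. Andrianov, V. G. Zhuravlev, *Modular Forms and Hecke Operators*,
  Ch. 1 §4.4–4.5 (Proposition 4.9, Lemma 4.13, (4.49)).
* [ConreyIwaniec2002] B. Conrey, H. Iwaniec, Acta Arith. 103 (2002) 259–312: Proposition 3.2
  (3.15), Proposition 3.3 (3.17), (3.20).
-/

noncomputable section

open scoped NumberTheorySymbols NumberField
open Complex Module NumberField Ideal
open Literature.NumberTheory.QuadraticFields.BinaryQuadraticForm (reducedForms)

namespace Literature.NumberTheory.LFunctions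

namespace ConreyIwaniec2002

open Literature.NumberTheory.ModularForms
open Literature.NumberTheory.EllipticCurves.ModularForms
open Literature.NumberTheory.QuadraticFields.Quadratic (BinQF)
open Literature.NumberTheory.Automorphic (cusp_datum)
open NumberField Literature.NumberTheory.LFunctions.NumberField

/-- **The genus phase of the untwisted binary Gauss sums, arithmetic form.** For `q` odd
squarefree, a modulus `c ≥ 1`, `s = (c,q)`, and a numerator `a` with `aā ≡ 1 (mod c)`, there is
ONE `E₀ ∈ ℂ` such that for EVERY primitive form `f` of discriminant `−q` whose leading
coefficient `f.a > 0` is a unit mod `c`: `G(a,c;f,0) = Σ_{x,y mod c} e(a f(x,y)/c) = (f.a/s)·E₀`.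
(`E₀ = χ₈(−q)^k 2^k (2^ka/c')(2^ka/c₁)·s·(r/c₁)·G(1;c')G(1;c₁)` for `c = 2^kc'`, `c' = sc₁`,
`r = q/s`; only its independence of `f` matters.) CRT in the modulus, the `2^k`-evaluation, and
completing the square modulo the odd part. [cite: AndrianovZhuravlev2015, Ch. 1 §4.4–4.5, Proposition 4.9, Lemma 4.13, (4.49)]
[cite: ConreyIwaniec2002, Proposition 3.2 (3.15), Proposition 3.3 (3.17)] -/
theorem gauss_sum_phase {q : ℕ} (hq : Squarefree q) (hqodd : Odd q) (c : ℕ) [NeZero c]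
    {a abar : ℤ} (hab : a * abar ≡ 1 [ZMOD c]) :
    ∃ E₀ : ℂ, ∀ f : BinQF, f.IsPrimitive → f.disc = -(q : ℤ) → 0 < f.a →
      IsUnit ((f.a : ℤ) : ZMod c) →
        binQuadGaussSum c f (a : ZMod c) 0 0 = (jacobiSym f.a (Nat.gcd c q) : ℂ) * E₀ := by
  classical
  have hc0 : 0 < c := Nat.pos_of_ne_zero (NeZero.ne c)
  -- `c = 2^k · c'`, `c'` odd
  obtain ⟨k, c', hc'odd, hc⟩ := Nat.exists_eq_two_pow_mul_odd (NeZero.ne c)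
  -- the cusp datum: `s = (c,q)`, `r = q/s`, `(r, c) = 1`
  obtain ⟨hs0, hsc, hqrs, hrs, hrc⟩ := cusp_datum hq hc0
  set s : ℕ := c.gcd q with hs
  set r : ℕ := q / c.gcd q with hr
  have hsodd : Odd s := Odd.of_dvd_nat hqodd (Nat.gcd_dvd_right c q)
  -- `s ∣ c'`
  have hsc' : s ∣ c' := by
    have h2s : Nat.Coprime s (2 ^ k) := ((Nat.coprime_two_left.mpr hsodd).pow_left k).symm
    rw [hc] at hsc
    exact h2s.dvd_of_dvd_mul_left hsc
  obtain ⟨c₁, hc₁⟩ := hsc'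
  have hc'0 : c' ≠ 0 := by rintro rfl; rw [mul_zero] at hc; exact (NeZero.ne c) hc
  have hc₁0 : c₁ ≠ 0 := by rintro rfl; rw [mul_zero] at hc₁; exact hc'0 hc₁
  haveI : NeZero (2 ^ k) := ⟨pow_ne_zero k two_ne_zero⟩
  haveI : NeZero c' := ⟨hc'0⟩
  haveI : NeZero s := ⟨hs0.ne'⟩
  haveI : NeZero c₁ := ⟨hc₁0⟩
  have hcop2 : Nat.Coprime (2 ^ k) c' := (Nat.coprime_two_left.mpr hc'odd).pow_left k
  -- `a` is prime to `c`
  have hac : IsCoprime a (c : ℤ) := by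
    have h1 : (a : ZMod c) * (abar : ZMod c) = 1 := by
      have := (ZMod.intCast_eq_intCast_iff (a := a * abar) (b := 1) (c := c)).mpr hab
      push_cast at this
      exact this
    exact ((ZMod.coe_int_isUnit_iff_isCoprime a c).mp (IsUnit.of_mul_eq_one _ h1)).symm
  have dvdc' : ((c' : ℕ) : ℤ) ∣ (c : ℤ) := ⟨2 ^ k, by rw [hc]; push_cast; ring⟩
  have dvdc₁ : ((c₁ : ℕ) : ℤ) ∣ (c : ℤ) := ⟨2 ^ k * s, by rw [hc, hc₁]; push_cast; ring⟩
  have hac' : (((2 ^ k : ℕ) : ℤ) * a).gcd c' = 1 := by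
    have h2c : IsCoprime ((2 ^ k : ℕ) : ℤ) (c' : ℤ) := Nat.isCoprime_iff_coprime.mpr hcop2
    exact Int.isCoprime_iff_gcd_eq_one.mp (h2c.mul_left (hac.of_isCoprime_of_dvd_right dvdc'))
  -- `(−r, c₁) = 1`
  have hD₁ : (-(r : ℤ)).gcd c₁ = 1 := by
    have h1 : IsCoprime (r : ℤ) (c : ℤ) := Nat.isCoprime_iff_coprime.mpr hrc
    exact Int.isCoprime_iff_gcd_eq_one.mp (h1.of_isCoprime_of_dvd_right dvdc₁).neg_left
  -- the `2`-part value (for `k ≥ 1` the numerator `c'a` is odd)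
  obtain ⟨T, hT⟩ : ∃ T : ℂ, ∀ f : BinQF, Odd f.b → f.disc = -(q : ℤ) →
      binQuadGaussSum (2 ^ k) f ((c' * a : ℤ) : ZMod (2 ^ k)) 0 0 = T := by
    rcases Nat.eq_zero_or_pos k with hk | hk
    · refine ⟨1, fun f _ _ ↦ ?_⟩
      exact binQuadGaussSum_eq_one_of_modulus_eq_one (by rw [hk, pow_zero]) f _ _ _
    · refine ⟨((ZMod.χ₈ (-(q : ℤ)) : ℤ) : ℂ) ^ k * 2 ^ k, fun f hb hd ↦ ?_⟩
      have haodd : Odd ((c' : ℤ) * a) := by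
        refine (Int.odd_coe_nat c' |>.mpr hc'odd).mul ?_
        rw [← Int.not_even_iff_odd, even_iff_two_dvd]
        intro h2a
        have h2c : (2 : ℤ) ∣ (c : ℤ) :=
          ⟨2 ^ (k - 1) * c', by
            rw [hc, show k = (k - 1) + 1 from (Nat.sub_add_cancel hk).symm]; push_cast; ring⟩
        have hu : IsUnit (2 : ℤ) := hac.isUnit_of_dvd' h2a h2c
        rcases Int.isUnit_iff.mp hu with h | h <;> norm_num at h
      rw [binQuadGaussSum_two_pow_eq f hb haodd k, hd]
      push_cast
      ring
  refine ⟨T * (((jacobiSym ((2 ^ k : ℕ) * a) c' * jacobiSym ((2 ^ k : ℕ) * a) c₁ : ℤ) : ℂ) *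
      (quadGaussSum c' 1 0 * s * ((jacobiSym (r : ℤ) c₁ : ℂ) * quadGaussSum c₁ 1 0))), ?_⟩
  intro f hf hd hA hunit
  -- `B` odd
  have hb : Odd f.b := by
    have hdodd : Odd f.disc := by rw [hd]; exact (Int.odd_coe_nat q |>.mpr hqodd).neg
    rw [BinQF.disc] at hdodd
    rcases Int.even_or_odd f.b with hev | hbo
    · exfalso
      have : Even (f.b ^ 2 - 4 * f.a * f.c) := by
        rw [show f.b ^ 2 - 4 * f.a * f.c = f.b ^ 2 + 2 * (-(2 * f.a * f.c)) by ring]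
        exact (Even.pow_of_ne_zero hev two_ne_zero).add (even_two_mul _)
      exact (Int.not_even_iff_odd.mpr hdodd) this
    · exact hbo
  -- `(A, c') = 1`
  have hAc : IsCoprime f.a (c : ℤ) := ((ZMod.coe_int_isUnit_iff_isCoprime f.a c).mp hunit).symm
  have hA' : f.a.gcd c' = 1 := Int.isCoprime_iff_gcd_eq_one.mp (hAc.of_isCoprime_of_dvd_right dvdc')
  have hA₁ : f.a.gcd c₁ = 1 := Int.isCoprime_iff_gcd_eq_one.mp (hAc.of_isCoprime_of_dvd_right dvdc₁)
  -- the factorisation of the discriminant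
  have hdisc : f.disc = (s : ℕ) * (-(r : ℤ)) := by
    rw [hd]
    have : (q : ℤ) = (r : ℤ) * (s : ℤ) := by rw [hr, hs]; exact_mod_cast hqrs
    rw [this]; ring
  -- split the modulus
  have hgoal : binQuadGaussSum c f (a : ZMod c) 0 0 =
      binQuadGaussSum (2 ^ k * c') f (a : ZMod (2 ^ k * c')) 0 0 := by
    subst hc; rfl
  rw [hgoal, show (0 : ZMod (2 ^ k * c')) = ((0 : ℤ) : ZMod (2 ^ k * c')) from Int.cast_zero.symm,
    binQuadGaussSum_mul_of_coprime hcop2 f a 0 0]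
  simp only [Int.cast_zero]
  rw [hT f hb hd, binQuadGaussSum_zero_zero_eq_of_factorisation hc'odd f hA' hc₁ hdisc hD₁ hac']
  -- Jacobi-symbol bookkeeping: `(A/c')(−A·(−r)/c₁) = (A/s)(A/c₁)²(r/c₁) = (A/s)(r/c₁)`
  have hJ1 : jacobiSym f.a c' = jacobiSym f.a s * jacobiSym f.a c₁ := by
    rw [hc₁]; exact jacobiSym.mul_right' _ (NeZero.ne s) hc₁0
  have hJ2 : jacobiSym (-(f.a * -(r : ℤ))) c₁ = jacobiSym f.a c₁ * jacobiSym (r : ℤ) c₁ := by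
    rw [show -(f.a * -(r : ℤ)) = f.a * r by ring, jacobiSym.mul_left]
  have hsq : ((jacobiSym f.a c₁ : ℤ) : ℂ) ^ 2 = 1 := by exact_mod_cast jacobiSym.sq_one hA₁
  rw [hJ1, hJ2]
  push_cast
  linear_combination T * ((jacobiSym ((2 : ℤ) ^ k * a) c' : ℂ) *
    (jacobiSym ((2 : ℤ) ^ k * a) c₁ : ℂ)) * (jacobiSym f.a s : ℂ) * quadGaussSum c' 1 0 *
    (s : ℂ) * (jacobiSym (r : ℤ) c₁ : ℂ) * quadGaussSum c₁ 1 0 * hsq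


/-- **Ω1 `stub_gauss_sum_genus` (sub-sub-skeleton `theta-omega` v1 :125), VERBATIM — the genus
phase of the quadratic Gauss sums of the reduced forms of discriminant `−q`**: for `q > 4` odd
with a primitive quadratic odd character, `K` with `d_K = −q` and integral basis `(1, ω)`,
`ω² = m + tω`, `c ≥ 1`, `ψ_s` the genus character of `s = (c,q)` by values, and `aā ≡ 1 (c)`:
ONE `E` with `‖E‖ = c√s` and `G(a,c;Q,0) = E·ψ_s([𝔞_Q])` for every reduced `Q`. Proof:
`gauss_sum_phase` (arithmetic: CRT, `2^k`-part, completing the square) feeds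
`gauss_sum_genus_of_phase` (class-group side: Cox 2.25 representative, `[𝔞_Q] = [𝔞_g]`,
genus values on ideals). [cite: ConreyIwaniec2002, Proposition 3.2 (3.15), Proposition 3.3 (3.17), (3.20); §2 (2.19)]
[cite: Cox2013, §2.C Lemma 2.25; §3.B Thm. 3.15; §7.B Thm. 7.7] -/
theorem gauss_sum_genus :
    ∀ (q : ℕ) [NeZero q], 4 < q → Odd q → ∀ χ : DirichletCharacter ℂ q,
      χ.IsPrimitive → χ.IsQuadratic → χ.Odd →
        ∀ (K : Type) [Field K] [NumberField K],
          Module.finrank ℚ K = 2 → NumberField.discr K = -(q : ℤ) →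
            ∀ (b : Basis (Fin 2) ℤ (𝓞 K)), b 0 = 1 → ∀ (t m : ℤ),
              b 1 * b 1 = (m : 𝓞 K) + (t : 𝓞 K) * b 1 →
                ∀ (c : ℕ) [NeZero c] (ψs : ClassGroup (𝓞 K) →* ℂˣ),
                  IsGenusCharFor ψs (Nat.gcd c q) →
                    ∀ a abar : ℤ, a * abar ≡ 1 [ZMOD c] →
                      ∃ E : ℂ, ‖E‖ = (c : ℝ) * Real.sqrt (Nat.gcd c q : ℕ) ∧
                        ∀ Q ∈ reducedForms (t ^ 2 + 4 * m),
                          binQuadGaussSum c ⟨Q.1, Q.2.1, Q.2.2⟩ (a : ZMod c) 0 0 =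
                            E * classGroupCharIdealHom ψs
                              (span {(Q.1 : 𝓞 K), b 1 - (((Q.2.1 + t) / 2 : ℤ) : 𝓞 K)}) := by
  intro q _ hq hodd χ hprim hquad _ K _ _ h2 hdisc b hb t m hω c _ ψs hψs a abar hab
  have hsqf : Squarefree q :=
    Literature.NumberTheory.LFunctions.PrimitiveQuadratic.squarefree_of_isPrimitive_of_isQuadratic
      hodd hprim hquad
  obtain ⟨E₀, hE₀⟩ := gauss_sum_phase hsqf hodd c hab
  exact gauss_sum_genus_of_phase q hodd χ hprim hquad h2 hdisc b hb hω c hψs hab hE₀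

end ConreyIwaniec2002

end Literature.NumberTheory.LFunctions

end
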